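import Summits.AtomisticToContinuum.Crystallization.Theorems.FrustratedLawDichotomyBumpAutocorrelation
import Summits.AtomisticToContinuum.Crystallization.Theorems.FrustratedLawDichotomySchurCutB
import Summits.AtomisticToContinuum.Crystallization.Theorems.FrustratedLawDichotomySchurDominationFloor
import Mathlib.MeasureTheory.Measure.Haar.NormedSpace

/-!
# FrustratedLawDichotomy · Schur floors `SF₅` / `SF₄₅` / `SF₄` from a DOMINATOR ALONE (radial bookkeeping discharged)

`…BumpAutocorrelation.bump_autocorr` (hand-1 g13) proves the profile identity `∫ β(x)β(x − v) dx = (512π/3465)·omega₂(‖v‖)` for lens-5 g34's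
quartic bump.  Here: §1 the radius-`a` bump `β_a(x) = (1 − ‖x‖²/a²)₊² = β(x/a)` and its profile
`∫ β_a(x)β_a(x − v) dx = a³·(512π/3465)·omega₂(‖v‖/a)` (scaling of Haar measure); §2 Bochner positivity of the overlap kernel
(`0 ≤ N + 2·Σ_{i<j} omega₂(r_ij/a)`, from `…SchurDomination.sum_sum_autocorr_eq_integral`), hence monotonicity of `SchurFloor w (omega₂(·/a)) A`
in `A`; §3 ★ `schurFloor_of_dominator`: hand-1 g12's `pairFloor_of_domination` with the profile hypothesis DISCHARGED — a nonnegative even integrable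
`K : ℝ³ → ℝ` with `−(V·w)(‖z‖) ≤ ∫ K(u)·∫ β_a(x)β_a(x − (z − u))` for all `z` gives `SchurFloor w (omega₂(·/a)) A` for every
`A ≥ ‖K‖₁·a³·256π/3465`; §4 the literal instances of `…SchurCutB`: ★ `sf₅_of_dominator` (`a = 1`, `A = 13/4000`), ★ `sf₄₅_of_dominator`
(`a = 4/5`, `A = 3/400`; the floor beneath the residual of record `T′♭₄₅`), `sf₄_of_dominator` (`a = 4/5`, `A = 29/2500`).

After this file the ONLY open input of `SF₅` / `SF₄₅` is lens-5's ONE-VARIABLE DOMINATION CERTIFICATE (a dominator `K` with the stated `L¹` budget;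
NODE-g34.md §3/§3bis closed forms `K(r) = (r⁻⁶/6)·smoothstep₁(…)`, census TAG 181-S(i) / amendment A certified the near field in exact rationals),
here in its honest 3-D form `∀ z` (the radialisation `(β_a⋆β_a) ∗ K` for radial `K` is the remaining bookkeeping).
[folklore] chaining; 0 sorry.  Prover hand 1, gen 13 (decomp-a2c), `--supports stmt-AtomisticToContinuum-27623`.
-/

noncomputable section

namespace Summit.AtomisticToContinuum.Crystallization.Theorems.FrustratedLawDichotomyBumpAutocorrelation

open MeasureTheory Set Real
open scoped BigOperators
open Literature.MathematicalPhysics.StatisticalMechanics (interactionEnergy)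
open Summit.AtomisticToContinuum.Crystallization.Theorems.FrustratedLawDichotomySchurCut
  (omega₂ omega₂_zero SchurFloor tailPot SF₅ SF₄₅ SF₄ w₅ w₄₅ w₄ ω₅ ω₄)
open Summit.AtomisticToContinuum.Crystallization.Theorems.FrustratedLawDichotomySchurDomination
  (pairFloor_of_domination sum_sum_autocorr_eq_integral sum_sum_eq_diag_add_two_mul_upper)

/-! ## §1. The bump of radius `a` and its profile -/

/-- **The quartic bump of radius `a`**: `β_a(x) = (1 − ‖x‖²/a²)₊² = β(x/a)`. -/
def bumpR (a : ℝ) (x : (EuclideanSpace ℝ (Fin 3))) : ℝ := clipSq (1 - ‖x‖ ^ 2 / a ^ 2)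

/-- `β_a(x) = β(a⁻¹x)`. [folklore] -/
theorem bumpR_eq (a : ℝ) (ha : a ≠ 0) (x : (EuclideanSpace ℝ (Fin 3))) : bumpR a x = bump (a⁻¹ • x) := by
  rw [bumpR, bump, norm_smul, Real.norm_eq_abs, mul_pow, sq_abs, inv_pow]
  congr 1
  field_simp

/-- `β_a ≥ 0`. [folklore] -/
theorem bumpR_nonneg (a : ℝ) (x : (EuclideanSpace ℝ (Fin 3))) : 0 ≤ bumpR a x := clipSq_nonneg _

/-- `β_a` is continuous. [folklore] -/
theorem continuous_bumpR (a : ℝ) : Continuous (bumpR a) :=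
  continuous_clipSq.comp (continuous_const.sub ((continuous_norm.pow 2).div_const _))

/-- `β_a` vanishes outside the ball of radius `a`. [folklore] -/
theorem bumpR_eq_zero {a : ℝ} (ha : 0 < a) {x : (EuclideanSpace ℝ (Fin 3))} (h : a ≤ ‖x‖) : bumpR a x = 0 := by
  refine clipSq_of_nonpos ?_
  have : a ^ 2 ≤ ‖x‖ ^ 2 := pow_le_pow_left₀ ha.le h 2
  have hlt : 0 < a ^ 2 := by positivity
  rw [sub_nonpos, le_div_iff₀ hlt, one_mul]
  exact this

/-- `β_a` has compact support. [folklore] -/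
theorem hasCompactSupport_bumpR {a : ℝ} (ha : 0 < a) : HasCompactSupport (bumpR a) := by
  refine HasCompactSupport.intro (isCompact_closedBall (0 : (EuclideanSpace ℝ (Fin 3))) a) fun x hx => bumpR_eq_zero ha ?_
  rw [Metric.mem_closedBall, dist_zero_right, not_le] at hx
  exact hx.le

/-- ★ **Autocorrelation profile at radius `a`**: `∫ β_a(x) β_a(x − v) dx = a³·(512π/3465)·omega₂(‖v‖/a)` (`a = 4/5`: the kernel `ω₄` of
`SF₄₅` / `SF₄`; `a = 1`: `ω₅` of `SF₅`). [folklore] -/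
theorem bumpR_autocorr {a : ℝ} (ha : 0 < a) (v : (EuclideanSpace ℝ (Fin 3))) :
    ∫ x, bumpR a x * bumpR a (x - v) = a ^ 3 * (512 * π / 3465) * omega₂ (‖v‖ / a) := by
  have h := MeasureTheory.Measure.integral_comp_inv_smul_of_nonneg (volume : Measure (EuclideanSpace ℝ (Fin 3)))
    (fun z => bump z * bump (z - a⁻¹ • v)) ha.le
  have hdim : Module.finrank ℝ (EuclideanSpace ℝ (Fin 3)) = 3 := by simp
  rw [hdim, bump_autocorr, norm_smul, Real.norm_eq_abs, abs_inv, abs_of_pos ha, smul_eq_mul] at h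
  rw [show (∫ x, bumpR a x * bumpR a (x - v)) = ∫ x, bump (a⁻¹ • x) * bump (a⁻¹ • x - a⁻¹ • v) from
    integral_congr_ae (Filter.Eventually.of_forall fun x => by simp only [bumpR_eq a ha.ne', smul_sub])]
  rw [h]
  rw [inv_mul_eq_div]
  ring


/-! ## §2. Bochner positivity of the overlap kernel; monotonicity of the floor in `A` -/

/-- **Bochner positivity of the overlap kernel**: `0 ≤ N + 2·Σ_{i<j} omega₂(r_ij/a)` for every finite configuration (`= ‖Σ_i β_a(· − y_i)‖²/c₀`).
[folklore] -/
theorem sum_omega_nonneg {a : ℝ} (ha : 0 < a) {N : ℕ} (y : Fin N → (EuclideanSpace ℝ (Fin 3))) :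
    0 ≤ (N : ℝ) + 2 * interactionEnergy (fun r => omega₂ (r / a)) y := by
  have hpos : 0 ≤ ∑ i, ∑ j, ∫ x, bumpR a x * bumpR a (x - (y i - y j - 0)) := by
    rw [sum_sum_autocorr_eq_integral (continuous_bumpR a) (hasCompactSupport_bumpR ha) y 0]
    refine integral_nonneg fun t => ?_
    simp only [add_zero]
    exact mul_self_nonneg _
  simp only [sub_zero, bumpR_autocorr ha] at hpos
  rw [sum_sum_eq_diag_add_two_mul_upper _ (fun i j => by rw [← norm_neg, neg_sub])] at hpos
  simp only [sub_self, norm_zero, zero_div, omega₂_zero, mul_one, Finset.sum_const, Finset.card_univ, Fintype.card_fin,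
    nsmul_eq_mul, ← Finset.mul_sum] at hpos
  unfold interactionEnergy
  simp only [dist_eq_norm]
  have hc : 0 < a ^ 3 * (512 * π / 3465) := by positivity
  have : 0 ≤ a ^ 3 * (512 * π / 3465) * ((N : ℝ) + 2 * ∑ i, ∑ j ∈ Finset.Ioi i, omega₂ (‖y i - y j‖ / a)) := by
    linarith
  exact (mul_nonneg_iff_of_pos_left hc).mp this

/-- `SchurFloor w (omega₂(·/a)) A` is monotone in the constant `A`. [folklore] -/
theorem schurFloor_mono_A {a : ℝ} (ha : 0 < a) {w : ℝ → ℝ} {A A' : ℝ} (h : SchurFloor w (fun r => omega₂ (r / a)) A)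
    (hA : A ≤ A') : SchurFloor w (fun r => omega₂ (r / a)) A' := fun N y => by
  have h1 := h N y
  have h2 := sum_omega_nonneg ha y
  nlinarith

/-! ## §3. A Schur floor from a dominator -/

/-- ★ **A SCHUR FLOOR FROM A DOMINATOR.**  For `a > 0`, a tail weight `w`, and a nonnegative, even, integrable `K : ℝ³ → ℝ` dominating the tail
through the bump autocorrelation, `−(V·w)(‖z‖) ≤ ∫ K(u)·∫ β_a(x)β_a(x − (z − u))` for every `z`, one has `SchurFloor w (omega₂(·/a)) A` for every
`A ≥ ‖K‖₁·a³·256π/3465` (hand-1 g12's `pairFloor_of_domination` with the PROFILE HYPOTHESIS DISCHARGED by `bumpR_autocorr`). [folklore] -/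
theorem schurFloor_of_dominator {a : ℝ} (ha : 0 < a) (w : ℝ → ℝ) (K : (EuclideanSpace ℝ (Fin 3)) → ℝ)
    (hK0 : ∀ u, 0 ≤ K u) (hKi : Integrable K) (hKev : ∀ u, K (-u) = K u)
    (hdom : ∀ z, -(tailPot w ‖z‖) ≤ ∫ u, K u * ∫ x, bumpR a x * bumpR a (x - (z - u)))
    {A : ℝ} (hA : (∫ u, K u) * (a ^ 3 * (256 * π / 3465)) ≤ A) :
    SchurFloor w (fun r => omega₂ (r / a)) A := by
  have hF : SchurFloor w (fun r => omega₂ (r / a)) ((∫ u, K u) * (a ^ 3 * (512 * π / 3465)) / 2) := fun N y => by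
    have h := pairFloor_of_domination (bumpR a) K (tailPot w) (fun r => omega₂ (r / a)) (a ^ 3 * (512 * π / 3465))
      (continuous_bumpR a) (hasCompactSupport_bumpR ha) (bumpR_nonneg a) hK0 hKi hKev
      (fun v => by rw [bumpR_autocorr ha]) (by simp [omega₂_zero]) hdom y
    convert h using 2
  exact schurFloor_mono_A ha hF (by linarith)

/-! ## §4. The literal instances of `…SchurCutB` -/

/-- ★ **`SF₅` from a dominator** (`a = 1`, `A = 13/4000`): the literal Schur floor of lens-5 g34 at range 5 holds as soon as ONE nonnegative even
integrable `K` with `‖K‖₁·256π/3465 ≤ 13/4000` dominates `V·w₅` through `β⋆β`. [folklore] -/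
theorem sf₅_of_dominator (K : (EuclideanSpace ℝ (Fin 3)) → ℝ) (hK0 : ∀ u, 0 ≤ K u) (hKi : Integrable K) (hKev : ∀ u, K (-u) = K u)
    (hdom : ∀ z, -(tailPot w₅ ‖z‖) ≤ ∫ u, K u * ∫ x, bumpR 1 x * bumpR 1 (x - (z - u)))
    (hA : (∫ u, K u) * (256 * π / 3465) ≤ 13 / 4000) : SF₅ := by
  have hω : (fun r => omega₂ (r / 1)) = ω₅ := by funext r; simp [ω₅]
  have h := schurFloor_of_dominator one_pos w₅ K hK0 hKi hKev hdom (A := 13 / 4000) (by simpa using hA)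
  rw [hω] at h
  exact h

/-- ★ **`SF₄₅` from a dominator** (`a = 4/5`, `A = 3/400`; the floor beneath the residual of record `T′♭₄₅`, critic row 505 (A)). [folklore] -/
theorem sf₄₅_of_dominator (K : (EuclideanSpace ℝ (Fin 3)) → ℝ) (hK0 : ∀ u, 0 ≤ K u) (hKi : Integrable K) (hKev : ∀ u, K (-u) = K u)
    (hdom : ∀ z, -(tailPot w₄₅ ‖z‖) ≤ ∫ u, K u * ∫ x, bumpR (4 / 5) x * bumpR (4 / 5) (x - (z - u)))
    (hA : (∫ u, K u) * ((4 / 5 : ℝ) ^ 3 * (256 * π / 3465)) ≤ 3 / 400) : SF₄₅ := by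
  have hω : (fun r => omega₂ (r / (4 / 5))) = ω₄ := by funext r; simp only [ω₄]; congr 1; ring
  have h := schurFloor_of_dominator (by norm_num : (0:ℝ) < 4 / 5) w₄₅ K hK0 hKi hKev hdom hA
  rw [hω] at h
  exact h

/-- **`SF₄` from a dominator** (`a = 4/5`, `A = 29/2500`; the range-4 instance). [folklore] -/
theorem sf₄_of_dominator (K : (EuclideanSpace ℝ (Fin 3)) → ℝ) (hK0 : ∀ u, 0 ≤ K u) (hKi : Integrable K) (hKev : ∀ u, K (-u) = K u)
    (hdom : ∀ z, -(tailPot w₄ ‖z‖) ≤ ∫ u, K u * ∫ x, bumpR (4 / 5) x * bumpR (4 / 5) (x - (z - u)))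
    (hA : (∫ u, K u) * ((4 / 5 : ℝ) ^ 3 * (256 * π / 3465)) ≤ 29 / 2500) : SF₄ := by
  have hω : (fun r => omega₂ (r / (4 / 5))) = ω₄ := by funext r; simp only [ω₄]; congr 1; ring
  have h := schurFloor_of_dominator (by norm_num : (0:ℝ) < 4 / 5) w₄ K hK0 hKi hKev hdom hA
  rw [hω] at h
  exact h

end Summit.AtomisticToContinuum.Crystallization.Theorems.FrustratedLawDichotomyBumpAutocorrelation

end
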